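import Mathlib.Analysis.LocallyConvex.Barrelled
import Literature.Analysis.FunctionSpaces.WightmanDistributionsProofs
import Literature.MathematicalPhysics.QuantumLattice.SchwartzTranslationCutoff
import HarnessLib

/-!
# Strong continuity of the smeared fields and density of compactly smeared monomial vectors

Topic `Literature/MathematicalPhysics/QuantumLattice` (trunk T-AQFT), companion of
`WightmanAxioms.lean`, written for the bounded form of Streater–Wightman's Thm 4-3
(`BoundedSeparating.lean`) in the decomposition of the Jost–Schroer theorem
(`Literature.Barriers.QuantumFields.JostSchroerCommutator`). Streater–Wightman use throughout
§3-3/§4-2 that "`φ(f)Ψ` depends continuously on `f`" in the *norm* of `ℋ` (e.g. (3-23)–(3-24),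
the definition of `Ψ_f` for general `f` by approximation, and the passage from `𝒟(𝒪)` to `𝒮` in
the proof of Thm 4-2), whereas axiom W1 (`IsWightmanQFT.tempered`) only records the *weak*
continuity `f ↦ ⟪χ, φ(f)ψ⟫`, `χ, ψ ∈ D`. This file supplies the upgrade:

* `continuous_of_dense_of_continuous_inner` (**proved**, functional analysis): a linear map `A`
  from a barrelled space into an inner product space which is weakly continuous against a dense
  subspace (`u ↦ ⟪χ, A u⟫` continuous for `χ` in a dense submodule) is continuous — the seminorm
  `‖A ·‖` is the supremum of the continuous seminorms `|⟪χ, A ·⟫|`, `‖χ‖ ≤ 1`, hence continuous on a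
  barrelled space (Mathlib's `Seminorm.continuous_iSup`, i.e. Banach–Steinhaus);
* `IsWightmanQFT.continuous_apply_field` (**proved**): for `w ∈ D` and an operator `B : D → D`
  with a formal adjoint on `D`, `f ↦ B φ_k(f) w ∈ ℋ` is norm continuous on `𝒮` (`𝒮` is barrelled,
  `Literature.Analysis.FunctionSpaces.barrelledSpace_schwartzMap`; W1 and hermiticity give the
  weak continuity against `D`); in particular `f ↦ φ_k(f) w` and `f ↦ φ(l) φ_k(f) w`;
* `IsWightmanQFT.inner_monomialVec_eq_zero_of_forall_hasCompactSupport` (**proved**): a vector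
  orthogonal to all monomial vectors `φ_{k₁}(f₁)⋯φ_{kₙ}(fₙ)Ω` with *compactly supported* `fᵢ` is
  orthogonal to all monomial vectors (induction on the number of non-compactly-supported slots,
  density of `𝒟` in `𝒮`, `exists_hasCompactSupport_tendsto`), hence zero by W4
  (`IsWightmanQFT.eq_zero_of_forall_inner_monomialVec_hasCompactSupport`).

## References

* R. F. Streater, A. S. Wightman, *PCT, Spin and Statistics, and All That* (1964), §3-3
  (3-23)–(3-24); §4-2 proof of Thm 4-2. [StreaterWightman1964]
* W. Rudin, *Functional Analysis* (2nd ed. 1991), Thm 2.6 / Thm 2.17 (Banach–Steinhaus).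
  [Rudin1991]

## Mathlib / tree

Used: `BarrelledSpace`, `Seminorm.continuous_iSup`, `Seminorm.bddAbove_range_iff`,
`Seminorm.coe_iSup_eq`, `innerSL`, `LinearMap.applyₗ`, `Dense.exists_dist_lt`; from the tree
`Literature.Analysis.FunctionSpaces.barrelledSpace_schwartzMap` (`SchwartzComplete`),
`IsWightmanQFT.tempered/hermitian/cyclic`, `WightmanData.monomialVec`,
`IsWightmanQFT.inner_fieldMonomial_left`, `IsWightmanQFT.denseRange_monomialCombH`
(`WightmanFunctionsProofs`), `exists_hasCompactSupport_tendsto` (`SchwartzTranslationCutoff`).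
-/

noncomputable section

open Filter
open _root_.Topology
open scoped InnerProductSpace SchwartzMap ComplexConjugate

namespace Literature.MathematicalPhysics.QuantumLattice

/-! ### Weak continuity on a dense subspace implies strong continuity (barrelled domain) -/

section Barrelled

variable {E : Type*} [AddCommGroup E] [Module ℂ E] [TopologicalSpace E] [IsTopologicalAddGroup E]
  [BarrelledSpace ℂ E]
  {H : Type*} [NormedAddCommGroup H] [InnerProductSpace ℂ H]

/-- Approximating the norm by inner products against a dense submodule: for `v ∈ H`, a dense
submodule `D` and `ε > 0` there is `χ ∈ D` with `‖χ‖ ≤ 1` and `‖v‖ − ε ≤ ‖⟪χ, v⟫‖`. [folklore] -/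
theorem exists_mem_norm_le_one_norm_sub_le_inner (D : Submodule ℂ H) (hD : Dense (D : Set H))
    (v : H) {ε : ℝ} (hε : 0 < ε) :
    ∃ χ : H, χ ∈ D ∧ ‖χ‖ ≤ 1 ∧ ‖v‖ - ε ≤ ‖⟪χ, v⟫_ℂ‖ := by
  by_cases hv : v = 0
  · exact ⟨0, D.zero_mem, by simp, by simp [hv, hε.le]⟩
  have hvpos : 0 < ‖v‖ := norm_pos_iff.2 hv
  set δ : ℝ := ε / 2 with hδ
  have hδpos : 0 < δ := by positivity
  have hε2 : ε = 2 * δ := by rw [hδ]; ring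
  obtain ⟨w, hwD, hwdist⟩ := hD.exists_dist_lt v hδpos
  rw [dist_comm, dist_eq_norm] at hwdist
  have hnorm_w : ‖w‖ ≤ ‖v‖ + δ := by
    calc ‖w‖ = ‖(w - v) + v‖ := by rw [sub_add_cancel]
      _ ≤ ‖w - v‖ + ‖v‖ := norm_add_le _ _
      _ ≤ ‖v‖ + δ := by linarith
  have hc : 0 < ‖v‖ + δ := by positivity
  -- `χ = (‖v‖ + δ)⁻¹ w`
  set c : ℝ := (‖v‖ + δ)⁻¹ with hc_def
  have hcpos : 0 < c := inv_pos.2 hc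
  refine ⟨(c : ℂ) • w, D.smul_mem _ hwD, ?_, ?_⟩
  · rw [norm_smul, Complex.norm_real, Real.norm_of_nonneg hcpos.le, hc_def,
      inv_mul_le_iff₀ hc, mul_one]
    exact hnorm_w
  · -- `|⟪w, v⟫| ≥ ‖v‖² − δ‖v‖`
    have h1 : ‖v‖ ^ 2 - δ * ‖v‖ ≤ ‖⟪w, v⟫_ℂ‖ := by
      have e : ⟪w, v⟫_ℂ = ⟪v, v⟫_ℂ + ⟪w - v, v⟫_ℂ := by
        rw [← inner_add_left]; congr 1; abel
      have h2 : ‖⟪w - v, v⟫_ℂ‖ ≤ δ * ‖v‖ :=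
        (norm_inner_le_norm _ _).trans (mul_le_mul_of_nonneg_right hwdist.le (norm_nonneg _))
      have h3 : ‖⟪v, v⟫_ℂ‖ = ‖v‖ ^ 2 := by
        rw [inner_self_eq_norm_sq_to_K, norm_pow, RCLike.norm_ofReal, abs_norm]
      have h4 : ‖⟪v, v⟫_ℂ‖ - ‖⟪w - v, v⟫_ℂ‖ ≤ ‖⟪v, v⟫_ℂ + ⟪w - v, v⟫_ℂ‖ := by
        have := norm_sub_norm_le ⟪v, v⟫_ℂ (-⟪w - v, v⟫_ℂ)
        rwa [norm_neg, sub_neg_eq_add] at this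
      rw [e]
      linarith
    rw [inner_smul_left, Complex.conj_ofReal, norm_mul, Complex.norm_real,
      Real.norm_of_nonneg hcpos.le, hc_def, le_inv_mul_iff₀ hc]
    have h5 : (‖v‖ + δ) * (‖v‖ - ε) ≤ ‖v‖ ^ 2 - δ * ‖v‖ := by
      rw [hε2]; nlinarith
    exact h5.trans h1

/-- **Weak continuity on a dense subspace implies strong continuity** for a linear map `A` from a
barrelled space `E` into an inner product space `H`: if `u ↦ ⟪χ, A u⟫` is continuous for every
`χ` in a dense submodule `D ⊆ H`, then `A` is continuous. Proof: the seminorms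
`p_χ = |⟪χ, A ·⟫|`, `χ ∈ D`, `‖χ‖ ≤ 1`, are continuous and pointwise bounded by `‖A ·‖`, so their
supremum is a continuous seminorm (Banach–Steinhaus in the form `Seminorm.continuous_iSup`); by
density it dominates `‖A ·‖`. [cite: Rudin1991, Thm 2.6] -/
theorem continuous_of_dense_of_continuous_inner (A : E →ₗ[ℂ] H) (D : Submodule ℂ H)
    (hD : Dense (D : Set H)) (hA : ∀ χ ∈ D, Continuous fun u => ⟪χ, A u⟫_ℂ) : Continuous A := by
  -- the index set and the seminorms
  let S := {χ : H // χ ∈ D ∧ ‖χ‖ ≤ 1}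
  let p : S → Seminorm ℂ E := fun χ =>
    (normSeminorm ℂ ℂ).comp (((innerSL ℂ (χ : H)).toLinearMap).comp A)
  have hp_apply : ∀ (χ : S) (u : E), p χ u = ‖⟪(χ : H), A u⟫_ℂ‖ := fun χ u => rfl
  have hp_cont : ∀ χ : S, Continuous (p χ) := fun χ => by
    change Continuous fun u => ‖⟪(χ : H), A u⟫_ℂ‖
    exact (hA χ χ.2.1).norm
  have hp_le : ∀ (χ : S) (u : E), p χ u ≤ ‖A u‖ := fun χ u => by
    rw [hp_apply]
    exact (norm_inner_le_norm _ _).trans (mul_le_of_le_one_left (norm_nonneg _) χ.2.2)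
  have hbdd : BddAbove (Set.range p) := by
    rw [Seminorm.bddAbove_range_iff]
    exact fun u => ⟨‖A u‖, by rintro _ ⟨χ, rfl⟩; exact hp_le χ u⟩
  have hq : Continuous (⨆ χ, ⇑(p χ) : E → ℝ) := Seminorm.continuous_iSup p hp_cont hbdd
  -- the supremum dominates `‖A ·‖`
  have hdom : ∀ u : E, ‖A u‖ ≤ (⨆ χ, ⇑(p χ) : E → ℝ) u := by
    intro u
    rw [iSup_apply]
    have hbdd' : BddAbove (Set.range fun χ : S => p χ u) :=
      ⟨‖A u‖, by rintro _ ⟨χ, rfl⟩; exact hp_le χ u⟩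
    refine le_of_forall_pos_lt_add fun ε hε => ?_
    obtain ⟨χ, hχD, hχ1, hχ⟩ := exists_mem_norm_le_one_norm_sub_le_inner D hD (A u) (half_pos hε)
    have h := le_ciSup hbdd' ⟨χ, hχD, hχ1⟩
    change ‖⟪χ, A u⟫_ℂ‖ ≤ _ at h
    linarith
  have h00 : (⨆ χ, ⇑(p χ) : E → ℝ) 0 = 0 := by
    rw [iSup_apply]
    have h : ∀ χ : S, (p χ) (0 : E) = 0 := fun χ => map_zero _
    simp only [h]
    exact Real.iSup_const_zero
  -- continuity of `A` at `0`, hence everywhere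
  refine continuous_of_continuousAt_zero A.toAddMonoidHom ?_
  change Tendsto A (𝓝 0) (𝓝 (A 0))
  rw [map_zero, tendsto_zero_iff_norm_tendsto_zero]
  have h0 : Tendsto (⨆ χ, ⇑(p χ) : E → ℝ) (𝓝 (0 : E)) (𝓝 0) := by
    have := hq.tendsto 0
    rwa [h00] at this
  exact squeeze_zero (fun u => norm_nonneg _) hdom h0

end Barrelled

/-! ### Strong continuity of the smeared fields on `D` -/

namespace IsWightmanQFT

variable {d : ℕ} {κ : Type*} {W : WightmanData d κ}

/-- **The smeared field is norm continuous in the test function**, after any operator with a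
formal adjoint on `D`: for `w ∈ D`, `k : κ`, and `B : D → D` admitting `B†` on `D`
(`⟪ψ, B† χ⟫ = ⟪B ψ, χ⟫`), the map `f ↦ B φ_k(f) w ∈ ℋ` is continuous on `𝒮(ℝ^{1+d})` (W1 gives
the continuity of `f ↦ ⟪χ, B φ_k(f) w⟫ = ⟪B† χ, φ_k(f) w⟫` for `χ ∈ D`, `D` is dense, and `𝒮` is
barrelled). Streater–Wightman use this silently ((3-23)–(3-24)). [cite: StreaterWightman1964, §3-3 eqs (3-23)-(3-24)] -/
theorem continuous_apply_field (hW : IsWightmanQFT W) (k : κ) (w : W.dom)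
    {B : W.dom →ₗ[ℂ] W.dom}
    (hB : ∃ B' : W.dom →ₗ[ℂ] W.dom, ∀ ψ χ : W.dom,
      ⟪(ψ : W.H), (B' χ : W.H)⟫_ℂ = ⟪(B ψ : W.H), (χ : W.H)⟫_ℂ) :
    Continuous fun f : 𝓢(SpaceTime d, ℂ) => (B (W.field k f w) : W.H) := by
  haveI : BarrelledSpace ℂ 𝓢(SpaceTime d, ℂ) :=
    Literature.Analysis.FunctionSpaces.barrelledSpace_schwartzMap
  obtain ⟨B', hB'⟩ := hB
  set A : 𝓢(SpaceTime d, ℂ) →ₗ[ℂ] W.H :=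
    W.dom.subtype ∘ₗ B ∘ₗ (LinearMap.applyₗ w ∘ₗ W.field k) with hA
  have hAf : ∀ f, A f = (B (W.field k f w) : W.H) := fun f => rfl
  have h := continuous_of_dense_of_continuous_inner A W.dom hW.dense_dom fun χ hχ => by
    have e : (fun f => ⟪χ, A f⟫_ℂ) = fun f =>
        ⟪(B' ⟨χ, hχ⟩ : W.H), (W.field k f w : W.H)⟫_ℂ := by
      funext f
      rw [hAf, ← inner_conj_symm, ← hB' (W.field k f w) ⟨χ, hχ⟩, inner_conj_symm]
    rw [e]
    exact hW.tempered k w (B' ⟨χ, hχ⟩)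
  exact h

/-- `f ↦ φ_k(f) w` is norm continuous (`B = 1`). [cite: StreaterWightman1964, §3-3 eqs (3-23)-(3-24)] -/
theorem continuous_field_apply (hW : IsWightmanQFT W) (k : κ) (w : W.dom) :
    Continuous fun f : 𝓢(SpaceTime d, ℂ) => (W.field k f w : W.H) :=
  hW.continuous_apply_field k w (B := LinearMap.id) ⟨LinearMap.id, fun _ _ => rfl⟩

/-- `f ↦ φ(l) φ_k(f) w` is norm continuous for every field monomial `φ(l)` (its formal adjoint is
`φ(l†)`, `IsWightmanQFT.inner_fieldMonomial_left`). [cite: StreaterWightman1964, §3-3 eqs (3-23)-(3-24)] -/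
theorem continuous_fieldMonomial_field_apply (hW : IsWightmanQFT W) (l : List (κ × 𝓢(SpaceTime d, ℂ)))
    (k : κ) (w : W.dom) :
    Continuous fun f : 𝓢(SpaceTime d, ℂ) => (W.fieldMonomial l (W.field k f w) : W.H) :=
  hW.continuous_apply_field k w (B := W.fieldMonomial l)
    ⟨W.fieldMonomial (WightmanData.starList l), fun ψ χ => (hW.inner_fieldMonomial_left l ψ χ).symm⟩

/-! ### Density of compactly smeared monomial vectors -/

/-- Updating one slot of a tuple of test functions splits the monomial vector:
`φ(f₀)⋯φ(f_{i-1}) φ_{kᵢ}(g) φ(f_{i+1})⋯φ(f_{n-1}) Ω = φ(l₁) φ_{kᵢ}(g) φ(l₂)Ω` with `l₁`, `l₂` the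
lists of the slots before and after `i`. [folklore] -/
theorem monomialVec_ofFn_update {n : ℕ} (k : Fin n → κ) (f : Fin n → 𝓢(SpaceTime d, ℂ))
    (i : Fin n) (g : 𝓢(SpaceTime d, ℂ)) :
    W.monomialVec (List.ofFn fun j => (k j, Function.update f i g j)) =
      W.fieldMonomial ((List.ofFn fun j => (k j, f j)).take i)
        (W.field (k i) g (W.monomialVec ((List.ofFn fun j => (k j, f j)).drop (i + 1)))) := by
  have h1 : (fun j => (k j, Function.update f i g j)) =
      Function.update (fun j => (k j, f j)) i (k i, g) := by
    funext j
    by_cases hj : j = i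
    · subst hj; simp
    · simp [Function.update_of_ne hj]
  rw [h1, Literature.Analysis.FunctionSpaces.List.ofFn_update', List.set_eq_take_append_cons_drop,
    if_pos (by simp), WightmanData.monomialVec, W.fieldMonomial_append, LinearMap.comp_apply,
    WightmanData.fieldMonomial_cons, LinearMap.comp_apply]
  rfl

/-- The monomial vector is norm continuous in each slot. [cite: StreaterWightman1964, §3-3 eqs (3-23)-(3-24)] -/
theorem continuous_monomialVec_update (hW : IsWightmanQFT W) {n : ℕ} (k : Fin n → κ)
    (f : Fin n → 𝓢(SpaceTime d, ℂ)) (i : Fin n) :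
    Continuous fun g : 𝓢(SpaceTime d, ℂ) =>
      (W.monomialVec (List.ofFn fun j => (k j, Function.update f i g j)) : W.H) := by
  simp only [monomialVec_ofFn_update]
  exact hW.continuous_fieldMonomial_field_apply _ (k i) _

/-- **A vector orthogonal to all compactly smeared monomial vectors is orthogonal to all monomial
vectors** (fixed length and labels): if `⟪X, φ_{k₁}(f₁)⋯φ_{kₙ}(fₙ)Ω⟫ = 0` whenever all `fᵢ` have
compact support, then the same holds for all Schwartz `fᵢ`. Induction on the number of slots
allowed to be non-compactly supported; each step approximates one slot by compactly supported
test functions (`exists_hasCompactSupport_tendsto`) and uses the norm continuity of the monomial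
vector in that slot. This is the passage "from `𝒟` to `𝒮`" of Streater–Wightman's proof of
Thm 4-2. [cite: StreaterWightman1964, §4-2 proof of Thm 4-2] -/
theorem inner_monomialVec_eq_zero_of_forall_hasCompactSupport (hW : IsWightmanQFT W) (X : W.H)
    {n : ℕ} (k : Fin n → κ)
    (h : ∀ f : Fin n → 𝓢(SpaceTime d, ℂ), (∀ i, HasCompactSupport (f i : SpaceTime d → ℂ)) →
      ⟪X, (W.monomialVec (List.ofFn fun i => (k i, f i)) : W.H)⟫_ℂ = 0)
    (f : Fin n → 𝓢(SpaceTime d, ℂ)) :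
    ⟪X, (W.monomialVec (List.ofFn fun i => (k i, f i)) : W.H)⟫_ℂ = 0 := by
  -- `C j`: the statement for tuples whose slots `≥ j` are compactly supported
  suffices hC : ∀ (j : ℕ) (f : Fin n → 𝓢(SpaceTime d, ℂ)),
      (∀ i : Fin n, j ≤ (i : ℕ) → HasCompactSupport (f i : SpaceTime d → ℂ)) →
      ⟪X, (W.monomialVec (List.ofFn fun i => (k i, f i)) : W.H)⟫_ℂ = 0 from
    hC n f fun i hi => absurd i.is_lt (not_lt.2 hi)
  intro j
  induction j with
  | zero => exact fun f hf => h f fun i => hf i (Nat.zero_le _)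
  | succ j ih =>
    intro f hf
    by_cases hj : j < n
    · set i₀ : Fin n := ⟨j, hj⟩ with hi₀
      obtain ⟨u, hu, hulim⟩ := exists_hasCompactSupport_tendsto (f i₀)
      -- the approximants have compactly supported slots `≥ j`
      have hzero : ∀ m, ⟪X, (W.monomialVec
          (List.ofFn fun i => (k i, Function.update f i₀ (u m) i)) : W.H)⟫_ℂ = 0 := by
        intro m
        refine ih _ fun i hi => ?_
        by_cases hii : i = i₀
        · subst hii; simpa using hu m
        · rw [Function.update_of_ne hii]
          refine hf i (lt_of_le_of_ne hi fun hji => hii ?_)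
          exact Fin.ext (by rw [hi₀]; exact hji.symm)
      -- pass to the limit in the slot `i₀`
      have hcont := ((hW.continuous_monomialVec_update k f i₀).tendsto (f i₀)).comp hulim
      rw [Function.update_eq_self] at hcont
      have hci : Continuous fun v : W.H => ⟪X, v⟫_ℂ := continuous_const.inner continuous_id
      have hlim := (hci.tendsto _).comp hcont
      have hconst : ((fun v : W.H => ⟪X, v⟫_ℂ) ∘ (fun g : 𝓢(SpaceTime d, ℂ) =>
          (W.monomialVec (List.ofFn fun i => (k i, Function.update f i₀ g i)) : W.H)) ∘ u) =
          fun _ => 0 := funext fun m => hzero m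
      rw [hconst] at hlim
      exact tendsto_nhds_unique hlim tendsto_const_nhds
    · exact ih f fun i hi => absurd (lt_of_lt_of_le i.is_lt (le_trans (not_lt.1 hj) hi)) (lt_irrefl _)

/-- **A vector orthogonal to all compactly smeared monomial vectors vanishes** (W4 and the
density above): if `⟪X, φ_{k₁}(f₁)⋯φ_{kₙ}(fₙ)Ω⟫ = 0` for all `n`, all labels and all compactly
supported `fᵢ`, then `X = 0`. [cite: StreaterWightman1964, §4-2 proof of Thm 4-2] -/
theorem eq_zero_of_forall_inner_monomialVec_hasCompactSupport (hW : IsWightmanQFT W) (X : W.H)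
    (h : ∀ (n : ℕ) (k : Fin n → κ) (f : Fin n → 𝓢(SpaceTime d, ℂ)),
      (∀ i, HasCompactSupport (f i : SpaceTime d → ℂ)) →
      ⟪X, (W.monomialVec (List.ofFn fun i => (k i, f i)) : W.H)⟫_ℂ = 0) : X = 0 := by
  have hall : ∀ l : List (κ × 𝓢(SpaceTime d, ℂ)), ⟪X, (W.monomialVec l : W.H)⟫_ℂ = 0 := by
    intro l
    have e : l = List.ofFn fun i : Fin l.length => ((l.get i).1, (l.get i).2) := by
      simp only [Prod.mk.eta, List.ofFn_get]
    rw [e]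
    exact hW.inner_monomialVec_eq_zero_of_forall_hasCompactSupport X (fun i => (l.get i).1)
      (h l.length _) _
  refine hW.cyclic.eq_zero_of_inner_left (𝕜 := ℂ) fun v hv => ?_
  refine Submodule.span_induction (p := fun v _ => ⟪X, v⟫_ℂ = 0) ?_ ?_ ?_ ?_ hv
  · rintro _ ⟨l, rfl⟩
    exact hall l
  · exact inner_zero_right _
  · intro v w _ _ hv hw
    rw [inner_add_right, hv, hw, add_zero]
  · intro c v _ hv
    rw [inner_smul_right, hv, mul_zero]

end IsWightmanQFT

end Literature.MathematicalPhysics.QuantumLattice
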